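import Mathlib
import Literature.Computability.AlgebraicComplexity.DeterminantalIdealSFT
import Summits.MatrixMultiplication.MatrixMultiplication.Theorems.SubgroupIdentityDesigns.Negative.TorusCube

/-!
# Negative lemma for the crux `SubgroupIdentityDesigns` (stmt-MatrixMultiplication-14079): LEVI COLLISION

Line `levi-free-rigid-outer-pieces`, stub `stub_rigidDesigns`, milestone M1 (outer-pair test).  The rigid outer
pair `H₁ = {[[u⁻,0],[X,t₁]]}`, `H₃ = {[[u⁺,Z],[0,t₃]]}` of `GL_{k+r}(𝔽_p)` has every BLOCK POINT
`g(X,s,Z) = [[1,Z],[X,XZ+s]] = [[1,0],[X,t₁]]·[[1,Z],[0,t₃]]` (`s = t₁t₃`) in its product set.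
**Levi collision** (`leviSum_psi_eq_zero`): if `γ (s - s') β = 0` with `γ ∈ M_{k×r}` right-invertible and
`β ∈ M_{r×k}` left-invertible, the weight `λ = Σ_{X,Z} ψ(tr γX + tr βZ)(δ_{g(X,s,Z)} - δ_{g(X,s',Z)})` is a
LEVEL-`k` ANNIHILATOR: `Σ_y λ(y)ψ(tr(My)) = 0` for all `M` of rank `≤ k`.  Proof: `tr(M g(X,s,Z)) = tr M₁₁ +
tr(M₁₂X) + tr(M₂₁Z) + tr(M₂₂XZ) + tr(M₂₂s)`, so the sum is `(ψ(tr M₂₂s) - ψ(tr M₂₂s'))ψ(tr M₁₁)S(M)`; write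
`M = VW` through `𝔽_p^k`, `M₂₂ = V'W'`; if `S(M) ≠ 0` the shifts `Z ↦ Z + Z₀` (`Z₀V' = 0`) and `X ↦ X + X₀`
(`W'X₀ = 0`) force `β = V'E`, `γ = RW'`, the one-sided inverses give `V' = β(β^LV')`, `W' = (W'γ^R)γ`, and
`tr(M₂₂(s-s')) = tr((β^LV')(W'γ^R)·γ(s-s')β) = 0`.  Consequence `no_idTest_of_leviCollision` (shape of
`no_idTest_of_torusCube`, no TPP, no middle group): a set containing all `g(X,t,Z)`, `g(X,1,Z)` with
`γ(t-1)β = 0`, `t ≠ 1` carries no level-`k` identity test.  A rank-`k` pair with `γDβ = 0` exists iff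
`rk D ≤ 2(r-k)`, so witnesses of `stub_rigidDesigns` (`k = 2ℓ`, `r = ℓn`) have `n ≤ 3` (note `M1-levi-collision.md`).
Index types: arbitrary finite `κ` (size `k`) and `ρ` (Levi block).
-/

set_option linter.dupNamespace false

noncomputable section

open scoped BigOperators
open Matrix

namespace Summit.MatrixMultiplication.MatrixMultiplication.Theorems.SubgroupIdentityDesigns.Negative

section LinearAlgebra -- kernel inclusion gives a factorisation

variable {F : Type*} [Field F]

/-- Over a field, a linear map `g` vanishing on `ker f` factors through `f`. [folklore] -/
theorem exists_comp_eq_of_ker_le {V W U : Type*} [AddCommGroup V] [Module F V] [AddCommGroup W]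
    [Module F W] [AddCommGroup U] [Module F U] (f : V →ₗ[F] W) (g : V →ₗ[F] U)
    (h : LinearMap.ker f ≤ LinearMap.ker g) : ∃ φ : W →ₗ[F] U, φ ∘ₗ f = g := by
  obtain ⟨φ, hφ⟩ := LinearMap.exists_extend
    (((LinearMap.ker f).liftQ g h) ∘ₗ (f.quotKerEquivRange.symm : LinearMap.range f →ₗ[F] V ⧸ LinearMap.ker f))
  refine ⟨φ, LinearMap.ext fun v => ?_⟩
  have hv := LinearMap.congr_fun hφ ⟨f v, LinearMap.mem_range_self f v⟩
  simp only [LinearMap.coe_comp, Function.comp_apply, Submodule.coe_subtype, LinearEquiv.coe_coe,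
    LinearMap.quotKerEquivRange_symm_apply_image, Submodule.mkQ_apply, Submodule.liftQ_apply] at hv
  simpa using hv

/-- Matrix form (columns): if `B x = 0` whenever `A x = 0`, then `B = E * A` for some `E`. [folklore] -/
theorem exists_eq_mul_of_mulVec_eq_zero {m n l : Type*} [Fintype m] [Fintype n] [Fintype l]
    [DecidableEq m] [DecidableEq n] [DecidableEq l] (A : Matrix m n F) (B : Matrix l n F)
    (h : ∀ x : n → F, A *ᵥ x = 0 → B *ᵥ x = 0) : ∃ E : Matrix l m F, B = E * A := by
  obtain ⟨φ, hφ⟩ := exists_comp_eq_of_ker_le (Matrix.toLin' A) (Matrix.toLin' B) (fun x hx => by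
    rw [LinearMap.mem_ker, Matrix.toLin'_apply] at hx ⊢
    exact h x hx)
  refine ⟨LinearMap.toMatrix' φ, ?_⟩
  have e : LinearMap.toMatrix' (Matrix.toLin' B) = LinearMap.toMatrix' (φ ∘ₗ Matrix.toLin' A) := by
    rw [hφ]
  rwa [LinearMap.toMatrix'_comp, LinearMap.toMatrix'_toLin', LinearMap.toMatrix'_toLin'] at e

/-- Matrix form (rows): if `z B = 0` whenever `z A = 0`, then `B = A * E` for some `E`. [folklore] -/
theorem exists_eq_mul_of_vecMul_eq_zero {m n l : Type*} [Fintype m] [Fintype n] [Fintype l]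
    [DecidableEq m] [DecidableEq n] [DecidableEq l] (A : Matrix m n F) (B : Matrix m l F)
    (h : ∀ z : m → F, z ᵥ* A = 0 → z ᵥ* B = 0) : ∃ E : Matrix n l F, B = A * E := by
  obtain ⟨E, hE⟩ := exists_eq_mul_of_mulVec_eq_zero Aᵀ Bᵀ (fun z hz => by
    rw [Matrix.mulVec_transpose] at hz ⊢
    exact h z hz)
  refine ⟨Eᵀ, ?_⟩
  have := congrArg Matrix.transpose hE
  rwa [Matrix.transpose_transpose, Matrix.transpose_mul, Matrix.transpose_transpose] at this

end LinearAlgebra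

section Blocks -- block points and the phase of `ψ(tr(M g))` at a block point

variable {F : Type*} [CommRing F] {κ ρ : Type*} [Fintype κ] [Fintype ρ] [DecidableEq κ] [DecidableEq ρ]

/-- The block point `g(X, s, Z) = [[1, Z], [X, X Z + s]]` (`= [[1,0],[X,1]] · diag(1, s) · [[1,Z],[0,1]]`). -/
def blockPt (X : Matrix ρ κ F) (s : Matrix ρ ρ F) (Z : Matrix κ ρ F) : Matrix (κ ⊕ ρ) (κ ⊕ ρ) F :=
  Matrix.fromBlocks 1 Z X (X * Z + s)

omit [DecidableEq κ] [DecidableEq ρ] in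
/-- Trace of a block matrix. -/
theorem trace_fromBlocks_eq (A : Matrix κ κ F) (B : Matrix κ ρ F) (C : Matrix ρ κ F) (D : Matrix ρ ρ F) :
    Matrix.trace (Matrix.fromBlocks A B C D) = Matrix.trace A + Matrix.trace D := by
  simp [Matrix.trace, Fintype.sum_sum_type]

omit [DecidableEq ρ] in
/-- **The phase at a block point**: `tr(M g(X,s,Z)) = tr M₁₁ + tr(M₁₂ X) + tr(M₂₁ Z) + tr(M₂₂ X Z) + tr(M₂₂ s)`. -/
theorem trace_mul_blockPt (M : Matrix (κ ⊕ ρ) (κ ⊕ ρ) F) (X : Matrix ρ κ F) (s : Matrix ρ ρ F)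
    (Z : Matrix κ ρ F) :
    Matrix.trace (M * blockPt X s Z) =
      Matrix.trace M.toBlocks₁₁ + Matrix.trace (M.toBlocks₁₂ * X) + Matrix.trace (M.toBlocks₂₁ * Z) +
        Matrix.trace (M.toBlocks₂₂ * (X * Z)) + Matrix.trace (M.toBlocks₂₂ * s) := by
  conv_lhs => rw [← Matrix.fromBlocks_toBlocks M]
  rw [blockPt, Matrix.fromBlocks_multiply, trace_fromBlocks_eq]
  simp only [Matrix.mul_one, Matrix.mul_add, Matrix.trace_add]
  ring

omit [Fintype ρ] in
/-- `g(X, s, Z) = 1` iff `X = 0`, `Z = 0`, `s = 1`. -/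
theorem blockPt_eq_one_iff (X : Matrix ρ κ F) (s : Matrix ρ ρ F) (Z : Matrix κ ρ F) :
    blockPt X s Z = 1 ↔ X = 0 ∧ Z = 0 ∧ s = 1 := by
  classical
  constructor
  · intro h
    rw [blockPt, ← Matrix.fromBlocks_one] at h
    obtain ⟨-, hZ, hX, hs⟩ := Matrix.fromBlocks_inj.1 h
    refine ⟨hX, hZ, ?_⟩
    rwa [hX, Matrix.zero_mul, zero_add] at hs
  · rintro ⟨rfl, rfl, rfl⟩
    rw [blockPt, Matrix.zero_mul, zero_add, Matrix.fromBlocks_one]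

end Blocks

section Collision -- the Levi-collision weight and the vanishing of its level-`k` Fourier sums

variable {p : ℕ} [Fact p.Prime] {κ ρ : Type} [Fintype κ] [Fintype ρ] [DecidableEq κ] [DecidableEq ρ]

/-- The Levi-collision functional `Λ(F) = Σ_{X,Z} ψ(tr(γX) + tr(βZ)) (F(g(X,t,Z)) - F(g(X,t',Z)))` (the pairing of
`F` with the weight `λ = Σ_{X,Z} ψ(tr γX + tr βZ)(δ_{g(X,t,Z)} - δ_{g(X,t',Z)})`). -/
def leviSum (γ : Matrix κ ρ (ZMod p)) (β : Matrix ρ κ (ZMod p)) (t t' : Matrix ρ ρ (ZMod p))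
    (F : Matrix (κ ⊕ ρ) (κ ⊕ ρ) (ZMod p) → ℂ) : ℂ :=
  ∑ X : Matrix ρ κ (ZMod p), ∑ Z : Matrix κ ρ (ZMod p),
    ZMod.stdAddChar (Matrix.trace (γ * X) + Matrix.trace (β * Z)) * (F (blockPt X t Z) - F (blockPt X t' Z))

/-- The inner double character sum `S(M) = Σ_{X,Z} ψ(tr((γ+M₁₂)X) + tr((β+M₂₁)Z) + tr(M₂₂ X Z))`. -/
def innerSum (γ : Matrix κ ρ (ZMod p)) (β : Matrix ρ κ (ZMod p)) (M₁₂ : Matrix κ ρ (ZMod p))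
    (M₂₁ : Matrix ρ κ (ZMod p)) (M₂₂ : Matrix ρ ρ (ZMod p)) : ℂ :=
  ∑ X : Matrix ρ κ (ZMod p), ∑ Z : Matrix κ ρ (ZMod p),
    ZMod.stdAddChar (Matrix.trace ((γ + M₁₂) * X) + Matrix.trace ((β + M₂₁) * Z) + Matrix.trace (M₂₂ * (X * Z)))

/-- Factorisation of the Levi sum at a character `ψ_M`:
`Λ(ψ_M) = ψ(tr M₁₁) (ψ(tr M₂₂ t) - ψ(tr M₂₂ t')) S(M)`. -/
theorem leviSum_psi_eq (γ : Matrix κ ρ (ZMod p)) (β : Matrix ρ κ (ZMod p)) (t t' : Matrix ρ ρ (ZMod p))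
    (M : Matrix (κ ⊕ ρ) (κ ⊕ ρ) (ZMod p)) :
    leviSum γ β t t' (fun g => ZMod.stdAddChar (Matrix.trace (M * g))) =
      ZMod.stdAddChar (Matrix.trace M.toBlocks₁₁) *
        (ZMod.stdAddChar (Matrix.trace (M.toBlocks₂₂ * t)) - ZMod.stdAddChar (Matrix.trace (M.toBlocks₂₂ * t'))) *
          innerSum γ β M.toBlocks₁₂ M.toBlocks₂₁ M.toBlocks₂₂ := by
  unfold leviSum innerSum
  rw [Finset.mul_sum]
  refine Finset.sum_congr rfl fun X _ => ?_
  rw [Finset.mul_sum]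
  refine Finset.sum_congr rfl fun Z _ => ?_
  simp only [trace_mul_blockPt, AddChar.map_add_eq_mul, Matrix.add_mul, Matrix.trace_add]
  ring

/-- A non-zero sum that reproduces itself up to the factor `ψ(c)` forces `c = 0` (`ψ` is primitive). -/
theorem eq_zero_of_psi_mul_eq {S : ℂ} {c : ZMod p} (h : ZMod.stdAddChar c * S = S) (hS : S ≠ 0) : c = 0 := by
  have h1 : (ZMod.stdAddChar c : ℂ) = 1 := by
    have : (ZMod.stdAddChar c - 1) * S = 0 := by rw [sub_mul, one_mul, h, sub_self]
    rcases mul_eq_zero.1 this with h0 | h0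
    · exact sub_eq_zero.1 h0
    · exact absurd h0 hS
  exact (AddChar.IsPrimitive.zmod_char_eq_one_iff p (ZMod.isPrimitive_stdAddChar p) c).1 h1

/-- **Z-shift.**  If `S(M) ≠ 0` with `M₂₁ = V' W₀`, `M₂₂ = V' W'`, then `z β = 0` whenever `z V' = 0`. -/
theorem vecMul_eq_zero_of_innerSum_ne_zero {τ : Type} [Fintype τ] [DecidableEq τ]
    (γ : Matrix κ ρ (ZMod p)) (β : Matrix ρ κ (ZMod p)) (M₁₂ : Matrix κ ρ (ZMod p))
    (V' : Matrix ρ τ (ZMod p)) (W₀ : Matrix τ κ (ZMod p)) (W' : Matrix τ ρ (ZMod p))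
    (hS : innerSum γ β M₁₂ (V' * W₀) (V' * W') ≠ 0) (z : ρ → ZMod p) (hz : z ᵥ* V' = 0) : z ᵥ* β = 0 := by
  funext i
  -- shift `Z ↦ Z + Z₀` with `Z₀ = e_i zᵀ`
  set Z₀ : Matrix κ ρ (ZMod p) := Matrix.vecMulVec (Pi.single i 1) z with hZ₀
  have hZ₀V : Z₀ * V' = 0 := by
    rw [hZ₀, Matrix.vecMulVec_mul, hz]
    ext a b
    simp [Matrix.vecMulVec_apply]
  have hshift : ∀ X : Matrix ρ κ (ZMod p), ∀ Z : Matrix κ ρ (ZMod p),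
      ZMod.stdAddChar (Matrix.trace ((γ + M₁₂) * X) + Matrix.trace ((β + V' * W₀) * (Z + Z₀)) +
        Matrix.trace (V' * W' * (X * (Z + Z₀)))) =
      ZMod.stdAddChar (Matrix.trace (β * Z₀)) *
        ZMod.stdAddChar (Matrix.trace ((γ + M₁₂) * X) + Matrix.trace ((β + V' * W₀) * Z) +
          Matrix.trace (V' * W' * (X * Z))) := by
    intro X Z
    rw [← AddChar.map_add_eq_mul]
    congr 1
    have h1 : Matrix.trace (V' * W₀ * Z₀) = 0 := by
      rw [Matrix.mul_assoc, Matrix.trace_mul_comm, Matrix.mul_assoc, hZ₀V, Matrix.mul_zero, Matrix.trace_zero]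
    have h2 : Matrix.trace (V' * W' * (X * Z₀)) = 0 := by
      rw [Matrix.trace_mul_comm, Matrix.mul_assoc, ← Matrix.mul_assoc Z₀, hZ₀V, Matrix.zero_mul, Matrix.mul_zero,
        Matrix.trace_zero]
    simp only [Matrix.mul_add, Matrix.add_mul, Matrix.trace_add, h1, h2]
    ring
  have hsum : ZMod.stdAddChar (Matrix.trace (β * Z₀)) * innerSum γ β M₁₂ (V' * W₀) (V' * W') =
      innerSum γ β M₁₂ (V' * W₀) (V' * W') := by
    unfold innerSum
    rw [Finset.mul_sum]
    refine Finset.sum_congr rfl fun X _ => ?_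
    -- reindex the right-hand `Z`-sum by the shift `Z ↦ Z + Z₀`
    conv_rhs => rw [← Equiv.sum_comp (Equiv.addRight Z₀)]
    rw [Finset.mul_sum]
    refine Finset.sum_congr rfl fun Z _ => ?_
    rw [Equiv.coe_addRight, hshift]
  have hc := eq_zero_of_psi_mul_eq hsum hS
  -- `tr(β Z₀) = (z β)_i`
  rw [hZ₀, Matrix.mul_vecMulVec, Matrix.trace_vecMulVec] at hc
  rw [Pi.zero_apply, ← hc, Matrix.mulVec_single_one, dotProduct_comm]
  rfl

/-- **X-shift.**  If `S(M) ≠ 0` with `M₁₂ = V₀ W'`, `M₂₂ = V' W'`, then `γ x = 0` whenever `W' x = 0`. -/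
theorem mulVec_eq_zero_of_innerSum_ne_zero {τ : Type} [Fintype τ] [DecidableEq τ]
    (γ : Matrix κ ρ (ZMod p)) (β : Matrix ρ κ (ZMod p)) (M₂₁ : Matrix ρ κ (ZMod p))
    (V₀ : Matrix κ τ (ZMod p)) (V' : Matrix ρ τ (ZMod p)) (W' : Matrix τ ρ (ZMod p))
    (hS : innerSum γ β (V₀ * W') M₂₁ (V' * W') ≠ 0) (x : ρ → ZMod p) (hx : W' *ᵥ x = 0) : γ *ᵥ x = 0 := by
  funext j
  -- shift `X ↦ X + X₀` with `X₀ = x e_jᵀ`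
  set X₀ : Matrix ρ κ (ZMod p) := Matrix.vecMulVec x (Pi.single j 1) with hX₀
  have hWX₀ : W' * X₀ = 0 := by
    rw [hX₀, Matrix.mul_vecMulVec, hx]
    ext a b
    simp [Matrix.vecMulVec_apply]
  have hshift : ∀ X : Matrix ρ κ (ZMod p), ∀ Z : Matrix κ ρ (ZMod p),
      ZMod.stdAddChar (Matrix.trace ((γ + V₀ * W') * (X + X₀)) + Matrix.trace ((β + M₂₁) * Z) +
        Matrix.trace (V' * W' * ((X + X₀) * Z))) =
      ZMod.stdAddChar (Matrix.trace (γ * X₀)) *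
        ZMod.stdAddChar (Matrix.trace ((γ + V₀ * W') * X) + Matrix.trace ((β + M₂₁) * Z) +
          Matrix.trace (V' * W' * (X * Z))) := by
    intro X Z
    rw [← AddChar.map_add_eq_mul]
    congr 1
    have h1 : Matrix.trace (V₀ * W' * X₀) = 0 := by
      rw [Matrix.mul_assoc, hWX₀, Matrix.mul_zero, Matrix.trace_zero]
    have h2 : Matrix.trace (V' * W' * (X₀ * Z)) = 0 := by
      rw [Matrix.mul_assoc, ← Matrix.mul_assoc W', hWX₀, Matrix.zero_mul, Matrix.mul_zero, Matrix.trace_zero]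
    simp only [Matrix.mul_add, Matrix.add_mul, Matrix.trace_add, h1, h2]
    ring
  have hsum : ZMod.stdAddChar (Matrix.trace (γ * X₀)) * innerSum γ β (V₀ * W') M₂₁ (V' * W') =
      innerSum γ β (V₀ * W') M₂₁ (V' * W') := by
    unfold innerSum
    conv_rhs => rw [← Equiv.sum_comp (Equiv.addRight X₀)]
    rw [Finset.mul_sum]
    refine Finset.sum_congr rfl fun X _ => ?_
    rw [Finset.mul_sum, Equiv.coe_addRight]
    refine Finset.sum_congr rfl fun Z _ => ?_
    rw [hshift]
  have hc := eq_zero_of_psi_mul_eq hsum hS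
  -- `tr(γ X₀) = (γ x)_j`
  rw [hX₀, Matrix.mul_vecMulVec, Matrix.trace_vecMulVec, dotProduct_single, mul_one] at hc
  rw [hc, Pi.zero_apply]

/-- **LEVI COLLISION: the level-`k` Fourier sums of the collision weight vanish.**  `γ` right-invertible, `β`
left-invertible, `γ (t - t') β = 0`, `rk M ≤ |κ|` ⇒ `Σ_{X,Z} ψ(tr γX + tr βZ)(ψ(tr(M g(X,t,Z))) - ψ(tr(M g(X,t',Z)))) = 0`. -/
theorem leviSum_psi_eq_zero (γ : Matrix κ ρ (ZMod p)) (β : Matrix ρ κ (ZMod p))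
    (γ' : Matrix ρ κ (ZMod p)) (β' : Matrix κ ρ (ZMod p)) (hγ : γ * γ' = 1) (hβ : β' * β = 1)
    (t t' : Matrix ρ ρ (ZMod p)) (hcol : γ * (t - t') * β = 0)
    (M : Matrix (κ ⊕ ρ) (κ ⊕ ρ) (ZMod p)) (hM : M.rank ≤ Fintype.card κ) :
    leviSum γ β t t' (fun g => ZMod.stdAddChar (Matrix.trace (M * g))) = 0 := by
  rw [leviSum_psi_eq]
  by_cases hS : innerSum γ β M.toBlocks₁₂ M.toBlocks₂₁ M.toBlocks₂₂ = 0
  · rw [hS, mul_zero]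
  -- rank factorisation `M = V W` through `𝔽_p^{|κ|}` and its blocks
  obtain ⟨V, W, hVW⟩ :=
    Literature.Computability.AlgebraicComplexity.exists_eq_mul_of_rank_le_fintype M hM
  set V₀ : Matrix κ (Fin (Fintype.card κ)) (ZMod p) := V.toRows₁ with hV₀
  set V' : Matrix ρ (Fin (Fintype.card κ)) (ZMod p) := V.toRows₂ with hV'
  set W₀ : Matrix (Fin (Fintype.card κ)) κ (ZMod p) := W.toCols₁ with hW₀
  set W' : Matrix (Fin (Fintype.card κ)) ρ (ZMod p) := W.toCols₂ with hW'
  have hMb : M = Matrix.fromBlocks (V₀ * W₀) (V₀ * W') (V' * W₀) (V' * W') := by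
    rw [hVW, ← Matrix.fromRows_mul_fromCols, Matrix.fromRows_toRows, Matrix.fromCols_toCols]
  have h12 : M.toBlocks₁₂ = V₀ * W' := by rw [hMb, Matrix.toBlocks_fromBlocks₁₂]
  have h21 : M.toBlocks₂₁ = V' * W₀ := by rw [hMb, Matrix.toBlocks_fromBlocks₂₁]
  have h22 : M.toBlocks₂₂ = V' * W' := by rw [hMb, Matrix.toBlocks_fromBlocks₂₂]
  -- the two shifts
  have hz : ∀ z : ρ → ZMod p, z ᵥ* V' = 0 → z ᵥ* β = 0 := by
    have hS' : innerSum γ β M.toBlocks₁₂ (V' * W₀) (V' * W') ≠ 0 := by rwa [← h21, ← h22]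
    exact vecMul_eq_zero_of_innerSum_ne_zero γ β _ V' W₀ W' hS'
  have hx : ∀ x : ρ → ZMod p, W' *ᵥ x = 0 → γ *ᵥ x = 0 := by
    have hS' : innerSum γ β (V₀ * W') M.toBlocks₂₁ (V' * W') ≠ 0 := by rwa [← h12, ← h22]
    exact mulVec_eq_zero_of_innerSum_ne_zero γ β _ V₀ V' W' hS'
  obtain ⟨E, hE⟩ := exists_eq_mul_of_vecMul_eq_zero V' β hz
  obtain ⟨R, hR⟩ := exists_eq_mul_of_mulVec_eq_zero W' γ hx
  -- one-sided inverses: `V' = β (β' V')`, `W' = (W' γ') γ`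
  let e : κ ≃ Fin (Fintype.card κ) := Fintype.equivFin κ
  have h1 : β' * V' * E = 1 := by rw [Matrix.mul_assoc, ← hE, hβ]
  have h1' : E * (β' * V') = 1 := (Matrix.mul_eq_one_comm_of_equiv e).1 h1
  have hVb : V' = β * (β' * V') := by
    calc V' = V' * (E * (β' * V')) := by rw [h1', Matrix.mul_one]
      _ = β * (β' * V') := by rw [← Matrix.mul_assoc, ← hE]
  have h2 : R * (W' * γ') = 1 := by rw [← Matrix.mul_assoc, ← hR, hγ]
  have h2' : W' * γ' * R = 1 := (Matrix.mul_eq_one_comm_of_equiv e).1 h2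
  have hWb : W' = W' * γ' * γ := by
    calc W' = W' * γ' * R * W' := by rw [h2', Matrix.one_mul]
      _ = W' * γ' * γ := by rw [Matrix.mul_assoc, ← hR]
  -- hence `tr(M₂₂ t) = tr(M₂₂ t')`
  have key : Matrix.trace (M.toBlocks₂₂ * t) = Matrix.trace (M.toBlocks₂₂ * t') := by
    rw [← sub_eq_zero, ← Matrix.trace_sub, ← Matrix.mul_sub, h22, hVb, hWb]
    have e1 : β * (β' * V') * (W' * γ' * γ) * (t - t') = β * (β' * V' * (W' * γ') * (γ * (t - t'))) := by
      simp only [Matrix.mul_assoc]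
    have e2 : β' * V' * (W' * γ') * (γ * (t - t')) * β = β' * V' * (W' * γ') * (γ * (t - t') * β) := by
      simp only [Matrix.mul_assoc]
    rw [e1, Matrix.trace_mul_comm, e2, hcol, Matrix.mul_zero, Matrix.trace_zero]
  rw [key, sub_self, mul_zero, zero_mul]

/-- The Levi sum of a level-`k` function `f_c = Σ_M c_M ψ_M` (`c` supported in rank `≤ |κ|`) vanishes. -/
theorem leviSum_fourier_eq_zero (γ : Matrix κ ρ (ZMod p)) (β : Matrix ρ κ (ZMod p))
    (γ' : Matrix ρ κ (ZMod p)) (β' : Matrix κ ρ (ZMod p)) (hγ : γ * γ' = 1) (hβ : β' * β = 1)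
    (t t' : Matrix ρ ρ (ZMod p)) (hcol : γ * (t - t') * β = 0)
    (c : Matrix (κ ⊕ ρ) (κ ⊕ ρ) (ZMod p) → ℂ) (hc : ∀ M, Fintype.card κ < M.rank → c M = 0) :
    leviSum γ β t t' (fun g => ∑ M : Matrix (κ ⊕ ρ) (κ ⊕ ρ) (ZMod p),
      c M * ZMod.stdAddChar (Matrix.trace (M * g))) = 0 := by
  -- linearity of `Λ` in `F`
  have hlin : leviSum γ β t t' (fun g => ∑ M : Matrix (κ ⊕ ρ) (κ ⊕ ρ) (ZMod p),
      c M * ZMod.stdAddChar (Matrix.trace (M * g))) =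
      ∑ M : Matrix (κ ⊕ ρ) (κ ⊕ ρ) (ZMod p),
        c M * leviSum γ β t t' (fun g => ZMod.stdAddChar (Matrix.trace (M * g))) := by
    symm
    calc (∑ M : Matrix (κ ⊕ ρ) (κ ⊕ ρ) (ZMod p),
          c M * leviSum γ β t t' (fun g => ZMod.stdAddChar (Matrix.trace (M * g))))
        = ∑ M : Matrix (κ ⊕ ρ) (κ ⊕ ρ) (ZMod p), ∑ X : Matrix ρ κ (ZMod p), ∑ Z : Matrix κ ρ (ZMod p),
            c M * (ZMod.stdAddChar (Matrix.trace (γ * X) + Matrix.trace (β * Z)) *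
              (ZMod.stdAddChar (Matrix.trace (M * blockPt X t Z)) -
                ZMod.stdAddChar (Matrix.trace (M * blockPt X t' Z)))) := by
          refine Finset.sum_congr rfl fun M _ => ?_
          unfold leviSum
          rw [Finset.mul_sum]
          refine Finset.sum_congr rfl fun X _ => ?_
          rw [Finset.mul_sum]
      _ = ∑ X : Matrix ρ κ (ZMod p), ∑ M : Matrix (κ ⊕ ρ) (κ ⊕ ρ) (ZMod p), ∑ Z : Matrix κ ρ (ZMod p),
            c M * (ZMod.stdAddChar (Matrix.trace (γ * X) + Matrix.trace (β * Z)) *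
              (ZMod.stdAddChar (Matrix.trace (M * blockPt X t Z)) -
                ZMod.stdAddChar (Matrix.trace (M * blockPt X t' Z)))) := Finset.sum_comm
      _ = ∑ X : Matrix ρ κ (ZMod p), ∑ Z : Matrix κ ρ (ZMod p), ∑ M : Matrix (κ ⊕ ρ) (κ ⊕ ρ) (ZMod p),
            c M * (ZMod.stdAddChar (Matrix.trace (γ * X) + Matrix.trace (β * Z)) *
              (ZMod.stdAddChar (Matrix.trace (M * blockPt X t Z)) -
                ZMod.stdAddChar (Matrix.trace (M * blockPt X t' Z)))) :=
          Finset.sum_congr rfl fun X _ => Finset.sum_comm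
      _ = _ := by
          unfold leviSum
          refine Finset.sum_congr rfl fun X _ => Finset.sum_congr rfl fun Z _ => ?_
          rw [← Finset.sum_sub_distrib, Finset.mul_sum]
          refine Finset.sum_congr rfl fun M _ => ?_
          ring
  rw [hlin]
  refine Finset.sum_eq_zero fun M _ => ?_
  by_cases hM : M.rank ≤ Fintype.card κ
  · rw [leviSum_psi_eq_zero γ β γ' β' hγ hβ t t' hcol M hM, mul_zero]
  · rw [hc M (not_le.1 hM), zero_mul]

/-- **NO LEVEL-`k` IDENTITY TEST ON A SET CONTAINING A LEVI COLLISION THROUGH `1`.**  `γ` right-invertible, `β`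
left-invertible, `t ≠ 1`, `γ (t - 1) β = 0`: if `S` contains every `g(X, t, Z)` and `g(X, 1, Z)` then no `c`
supported in rank `≤ |κ|` has `f_c(1) = 1` and `f_c = 0` on `S ∖ {1}` (`f_c(g) = Σ_M c_M ψ(tr(M g))`).  No TPP, no
middle group: for the rigid pair (`g(X,t₁t₃,Z) = [[1,0],[X,t₁]]·[[1,Z],[0,t₃]] ∈ H₁H₃`) this kills `stub_rigidDesigns`
at every `(T₁,T₃)` with a collision, in particular whenever `r ≥ 2k` (every `t ∈ T₁ ∖ 1` collides with `1`). -/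
theorem no_idTest_of_leviCollision (γ : Matrix κ ρ (ZMod p)) (β : Matrix ρ κ (ZMod p))
    (γ' : Matrix ρ κ (ZMod p)) (β' : Matrix κ ρ (ZMod p)) (hγ : γ * γ' = 1) (hβ : β' * β = 1)
    (t : Matrix ρ ρ (ZMod p)) (ht : t ≠ 1) (hcol : γ * (t - 1) * β = 0)
    (S : Set (Matrix (κ ⊕ ρ) (κ ⊕ ρ) (ZMod p)))
    (hSt : ∀ (X : Matrix ρ κ (ZMod p)) (Z : Matrix κ ρ (ZMod p)), blockPt X t Z ∈ S)
    (hS1 : ∀ (X : Matrix ρ κ (ZMod p)) (Z : Matrix κ ρ (ZMod p)), blockPt X 1 Z ∈ S)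
    (c : Matrix (κ ⊕ ρ) (κ ⊕ ρ) (ZMod p) → ℂ) (hc : ∀ M, Fintype.card κ < M.rank → c M = 0)
    (h1 : (∑ M : Matrix (κ ⊕ ρ) (κ ⊕ ρ) (ZMod p), c M * ZMod.stdAddChar (Matrix.trace (M * 1))) = 1)
    (h0 : ∀ s ∈ S, s ≠ 1 →
      (∑ M : Matrix (κ ⊕ ρ) (κ ⊕ ρ) (ZMod p), c M * ZMod.stdAddChar (Matrix.trace (M * s))) = 0) :
    False := by
  set f : Matrix (κ ⊕ ρ) (κ ⊕ ρ) (ZMod p) → ℂ := fun g =>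
    ∑ M : Matrix (κ ⊕ ρ) (κ ⊕ ρ) (ZMod p), c M * ZMod.stdAddChar (Matrix.trace (M * g)) with hf
  have hzero : leviSum γ β t 1 f = 0 := leviSum_fourier_eq_zero γ β γ' β' hγ hβ t 1 hcol c hc
  -- read the sum directly: only the point `g(0, 1, 0) = 1` contributes, with weight `-1`
  have hval : ∀ (X : Matrix ρ κ (ZMod p)) (Z : Matrix κ ρ (ZMod p)),
      ZMod.stdAddChar (Matrix.trace (γ * X) + Matrix.trace (β * Z)) * (f (blockPt X t Z) - f (blockPt X 1 Z)) =
        if X = 0 ∧ Z = 0 then -1 else 0 := by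
    intro X Z
    have hft : f (blockPt X t Z) = 0 := h0 _ (hSt X Z) fun h => by
      obtain ⟨-, -, h3⟩ := (blockPt_eq_one_iff X t Z).1 h
      exact ht h3
    by_cases hXZ : X = 0 ∧ Z = 0
    · obtain ⟨rfl, rfl⟩ := hXZ
      have hb : blockPt (0 : Matrix ρ κ (ZMod p)) (1 : Matrix ρ ρ (ZMod p)) (0 : Matrix κ ρ (ZMod p)) = 1 :=
        (blockPt_eq_one_iff _ _ _).2 ⟨rfl, rfl, rfl⟩
      have hf1 : f 1 = 1 := h1
      rw [if_pos ⟨rfl, rfl⟩, hft, hb, hf1]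
      simp
    · have hf1 : f (blockPt X 1 Z) = 0 := h0 _ (hS1 X Z) fun h => by
        obtain ⟨h1', h2', -⟩ := (blockPt_eq_one_iff X 1 Z).1 h
        exact hXZ ⟨h1', h2'⟩
      rw [if_neg hXZ, hft, hf1, sub_self, mul_zero]
  have hsum : leviSum γ β t 1 f = -1 := by
    unfold leviSum
    simp_rw [hval]
    rw [Finset.sum_eq_single (0 : Matrix ρ κ (ZMod p))]
    · rw [Finset.sum_eq_single (0 : Matrix κ ρ (ZMod p))]
      · simp
      · intro Z _ hZ
        rw [if_neg fun h => hZ h.2]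
      · intro h; exact absurd (Finset.mem_univ _) h
    · intro X _ hX
      exact Finset.sum_eq_zero fun Z _ => by rw [if_neg fun h => hX h.1]
    · intro h; exact absurd (Finset.mem_univ _) h
  rw [hsum] at hzero
  norm_num at hzero

end Collision

end Summit.MatrixMultiplication.MatrixMultiplication.Theorems.SubgroupIdentityDesigns.Negative

end
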